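import Summits.QuantumFields.YangMills.Theorems.BalabanLadderIRTwistedSlabExpChartTaylor
import HarnessLib

/-!
# Uniformity of the second-order expansion over a gauge orbit: the chart action at `g • L` is the chart action at `L` composed with
# the isometry `a ↦ a^g`, so the Taylor remainder, the differential and the Hessian form are TRANSPORTED along the critical orbit —
# the `hS2` window `δ(ε)` of the Morse–Bott Laplace method is orbit-independent (M1a of the T1-tree-exact roadmap)

HELPER toward stub **T1** `TwistedSlabAnchor` (LINE `twisted-slab-continuity`, crux `IRcof` stmt-QuantumFields-26930, census row 43;
LEAD prover ym-ir-line-tsc-p1 g3; `--supports` the crux, `--as helper`).  Sequel of `…TwistedSlabExpChartTaylor` (K5).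
* §1 transport identities for a gauge map `g : FinTorusSite → SU(N)` and a configuration `L`:
  `chartAction_eq_lineAction_one`, `conjFluct_zero`, ★ `chartAction_gaugeAct` (`chartAction (↑(g•L)) c a = chartAction (↑L) c a^g`),
  ★ `fderiv_chartAction_gaugeAct_apply` (`D chartAction_{g•L}(0) a = D chartAction_L(0) a^g`, through the line derivative),
  ★ `hessian_chartAction_gaugeAct_apply_self` (`D² chartAction_{g•L}(0)(a,a) = D² chartAction_L(0)(a^g,a^g)`, through the line Hessian),
  `taylorRemainder_gaugeAct` (the whole second-order remainder is transported), `norm_conjFluct` (`‖a^g‖ = ‖a‖` in the chart's norm).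
* §2 ★★ `taylor_two_uniform_on_orbit`: for every `ε > 0` there is `δ > 0` such that for EVERY gauge map `g` and every fluctuation `a` with `‖a‖ < δ`:
  `|chartAction_{↑(g•L)}(a) − chartAction_{↑(g•L)}(0) − D(0)a − ½ D²(0)(a,a)| ≤ ε ‖a‖²` — ONE window for the whole orbit `𝒢 • L` (no compactness used: exact
  transport); ★★ `hS2_uniform_on_orbit_skew`: at a twist-EATING unitary `L` and on skew-Hermitian `a` the constant and linear terms drop
  (`chartAction = 0`, `D(0)a = 0` by K4), leaving `|chartAction_{↑(g•L)}(a) − ½ D²_{g•L}(0)(a,a)| ≤ ε ‖a‖²` uniformly in `g` — literally the shape of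
  hypothesis `hS2` of `Literature.Analysis.Asymptotics.tendsto_laplaceMethod_fibred` with parameter `p = g`, `S₀ = 0`.
NOT here (honest scope): the Hilbert model `V` (skew, traceless, Coulomb) with Lebesgue measure and the identification `⟪A p y, y⟫ = D²(0)(y,y)` as a
linear operator, the Haar density ∕ slice Jacobian (M1b), the separation hypothesis `hsep` (K2's zero set + compactness), M3, M4; T1-box 0∕1, T1 0∕1.

HONEST FRAMING: calculus∕bookkeeping on one box; nothing here bears on `IRcof`, `IR`, or the Yang–Mills mass gap (Clay: NOT proved); R4 =
`BalabanLadder.UV` only.  References: K. W. Breitung, LNM 1592 (1994) Thm 41; H.-K. Hwang, Ann. Probab. 8 (1980) (Laplace on a manifold of minima);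
M. García Pérez, A. González-Arroyo, M. Okawa, JHEP 10 (2017) 150 §2.2–2.3 (gauge-equivalent zero-action solutions).
-/

set_option autoImplicit false

noncomputable section

open scoped Matrix Matrix.Norms.Frobenius Topology
open Finset NormedSpace Filter Asymptotics
open Literature.MathematicalPhysics.QuantumFieldTheory Literature.MathematicalPhysics.QuantumLattice
open Literature.MathematicalPhysics.QuantumLattice.WilsonSecondVariation
open Literature.Analysis.Asymptotics

namespace Summit.QuantumFields.YangMills.Cruxes.IRcof.TwistedSlab

variable {N : ℕ} {n₀ n₁ n₂ n₃ : ℕ}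

/-! ## §1 Transport of the chart action, its differential and its Hessian along a gauge orbit -/

section Transport

/-- `chartAction U c a = lineAction U a c 1`. [folklore] -/
theorem chartAction_eq_lineAction_one (U : FinTorusSite n₀ n₁ n₂ n₃ × Fin 4 → Matrix (Fin N) (Fin N) ℂ)
    (c : FinTorusSite n₀ n₁ n₂ n₃ → Fin 4 → Fin 4 → ℂ) (a : Fin 4 → FinTorusSite n₀ n₁ n₂ n₃ → Matrix (Fin N) (Fin N) ℂ) :
    chartAction U c a = lineAction U a c 1 := by
  have h := chartAction_smul U c a 1
  rwa [one_smul] at h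

/-- `0^g = 0`. [folklore] -/
theorem conjFluct_zero (g : FinTorusSite n₀ n₁ n₂ n₃ → Matrix (Fin N) (Fin N) ℂ) :
    conjFluct g (0 : Fin 4 → FinTorusSite n₀ n₁ n₂ n₃ → Matrix (Fin N) (Fin N) ℂ) = 0 := by
  funext μ x; simp [conjFluct]

variable (g : FinTorusSite n₀ n₁ n₂ n₃ → Matrix.specialUnitaryGroup (Fin N) ℂ)
  (L : FinTorusSite n₀ n₁ n₂ n₃ × Fin 4 → Matrix.specialUnitaryGroup (Fin N) ℂ)
  (c : FinTorusSite n₀ n₁ n₂ n₃ → Fin 4 → Fin 4 → ℂ)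

/-- ★ **The chart action at `g • L` is the chart action at `L` in the transported direction**: `chartAction (↑(g•L)) c a = chartAction (↑L) c a^g`.
[cite: GarciaperezGonzalezarroyoOkawa2017, §2.2 (gauge-equivalent zero-action solutions)] -/
theorem chartAction_gaugeAct (a : Fin 4 → FinTorusSite n₀ n₁ n₂ n₃ → Matrix (Fin N) (Fin N) ℂ) :
    chartAction (fun e => ((gaugeAct g L e : Matrix.specialUnitaryGroup (Fin N) ℂ) : Matrix (Fin N) (Fin N) ℂ)) c a =
      chartAction (fun e => ((L e : Matrix.specialUnitaryGroup (Fin N) ℂ) : Matrix (Fin N) (Fin N) ℂ)) c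
        (conjFluct (fun y => (g y : Matrix (Fin N) (Fin N) ℂ)) a) := by
  rw [chartAction_eq_lineAction_one, chartAction_eq_lineAction_one, lineAction_gaugeAct]

/-- ★ **The differential is transported**: `D chartAction_{g•L}(0) a = D chartAction_L(0) a^g` (both are line derivatives of `lineAction`).
[folklore] -/
theorem fderiv_chartAction_gaugeAct_apply (a : Fin 4 → FinTorusSite n₀ n₁ n₂ n₃ → Matrix (Fin N) (Fin N) ℂ) :
    fderiv ℝ (chartAction (fun e => ((gaugeAct g L e : Matrix.specialUnitaryGroup (Fin N) ℂ) : Matrix (Fin N) (Fin N) ℂ)) c) 0 a =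
      fderiv ℝ (chartAction (fun e => ((L e : Matrix.specialUnitaryGroup (Fin N) ℂ) : Matrix (Fin N) (Fin N) ℂ)) c) 0
        (conjFluct (fun y => (g y : Matrix (Fin N) (Fin N) ℂ)) a) := by
  have h1 := (differentiable_chartAction (fun e => ((gaugeAct g L e : Matrix.specialUnitaryGroup (Fin N) ℂ) : Matrix (Fin N) (Fin N) ℂ)) c 0).lineDeriv_eq_fderiv
    (v := a)
  have h2 := (differentiable_chartAction (fun e => ((L e : Matrix.specialUnitaryGroup (Fin N) ℂ) : Matrix (Fin N) (Fin N) ℂ)) c 0).lineDeriv_eq_fderiv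
    (v := conjFluct (fun y => (g y : Matrix (Fin N) (Fin N) ℂ)) a)
  calc fderiv ℝ (chartAction (fun e => ((gaugeAct g L e : Matrix.specialUnitaryGroup (Fin N) ℂ) : Matrix (Fin N) (Fin N) ℂ)) c) 0 a
      = lineDeriv ℝ (chartAction (fun e => ((gaugeAct g L e : Matrix.specialUnitaryGroup (Fin N) ℂ) : Matrix (Fin N) (Fin N) ℂ)) c) 0 a := h1.symm
    _ = deriv (lineAction (fun e => ((gaugeAct g L e : Matrix.specialUnitaryGroup (Fin N) ℂ) : Matrix (Fin N) (Fin N) ℂ)) a c) 0 :=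
        lineDeriv_chartAction_zero _ c a
    _ = deriv (lineAction (fun e => ((L e : Matrix.specialUnitaryGroup (Fin N) ℂ) : Matrix (Fin N) (Fin N) ℂ))
          (conjFluct (fun y => (g y : Matrix (Fin N) (Fin N) ℂ)) a) c) 0 := by rw [lineAction_gaugeAct]
    _ = lineDeriv ℝ (chartAction (fun e => ((L e : Matrix.specialUnitaryGroup (Fin N) ℂ) : Matrix (Fin N) (Fin N) ℂ)) c) 0
          (conjFluct (fun y => (g y : Matrix (Fin N) (Fin N) ℂ)) a) := (lineDeriv_chartAction_zero _ c _).symm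
    _ = _ := h2

/-- ★ **The Hessian form on the diagonal is transported**: `D² chartAction_{g•L}(0)(a,a) = D² chartAction_L(0)(a^g,a^g)`. [folklore] -/
theorem hessian_chartAction_gaugeAct_apply_self (a : Fin 4 → FinTorusSite n₀ n₁ n₂ n₃ → Matrix (Fin N) (Fin N) ℂ) :
    fderiv ℝ (fderiv ℝ (chartAction (fun e => ((gaugeAct g L e : Matrix.specialUnitaryGroup (Fin N) ℂ) : Matrix (Fin N) (Fin N) ℂ)) c)) 0 a a =
      fderiv ℝ (fderiv ℝ (chartAction (fun e => ((L e : Matrix.specialUnitaryGroup (Fin N) ℂ) : Matrix (Fin N) (Fin N) ℂ)) c)) 0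
        (conjFluct (fun y => (g y : Matrix (Fin N) (Fin N) ℂ)) a) (conjFluct (fun y => (g y : Matrix (Fin N) (Fin N) ℂ)) a) := by
  rw [fderiv_fderiv_chartAction_apply_self, fderiv_fderiv_chartAction_apply_self, lineAction_gaugeAct]

/-- **The whole second-order Taylor remainder is transported along the orbit.** [folklore] -/
theorem taylorRemainder_gaugeAct (a : Fin 4 → FinTorusSite n₀ n₁ n₂ n₃ → Matrix (Fin N) (Fin N) ℂ) :
    chartAction (fun e => ((gaugeAct g L e : Matrix.specialUnitaryGroup (Fin N) ℂ) : Matrix (Fin N) (Fin N) ℂ)) c a -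
        chartAction (fun e => ((gaugeAct g L e : Matrix.specialUnitaryGroup (Fin N) ℂ) : Matrix (Fin N) (Fin N) ℂ)) c 0 -
        fderiv ℝ (chartAction (fun e => ((gaugeAct g L e : Matrix.specialUnitaryGroup (Fin N) ℂ) : Matrix (Fin N) (Fin N) ℂ)) c) 0 a -
        (1 / 2) * fderiv ℝ (fderiv ℝ (chartAction (fun e => ((gaugeAct g L e : Matrix.specialUnitaryGroup (Fin N) ℂ) : Matrix (Fin N) (Fin N) ℂ)) c)) 0 a a =
      chartAction (fun e => ((L e : Matrix.specialUnitaryGroup (Fin N) ℂ) : Matrix (Fin N) (Fin N) ℂ)) c (conjFluct (fun y => (g y : Matrix (Fin N) (Fin N) ℂ)) a) -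
        chartAction (fun e => ((L e : Matrix.specialUnitaryGroup (Fin N) ℂ) : Matrix (Fin N) (Fin N) ℂ)) c 0 -
        fderiv ℝ (chartAction (fun e => ((L e : Matrix.specialUnitaryGroup (Fin N) ℂ) : Matrix (Fin N) (Fin N) ℂ)) c) 0
          (conjFluct (fun y => (g y : Matrix (Fin N) (Fin N) ℂ)) a) -
        (1 / 2) * fderiv ℝ (fderiv ℝ (chartAction (fun e => ((L e : Matrix.specialUnitaryGroup (Fin N) ℂ) : Matrix (Fin N) (Fin N) ℂ)) c)) 0
          (conjFluct (fun y => (g y : Matrix (Fin N) (Fin N) ℂ)) a) (conjFluct (fun y => (g y : Matrix (Fin N) (Fin N) ℂ)) a) := by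
  rw [chartAction_gaugeAct, fderiv_chartAction_gaugeAct_apply, hessian_chartAction_gaugeAct_apply_self,
    chartAction_gaugeAct g L c 0, conjFluct_zero]

/-- In the Frobenius norm, `‖X‖ = √S(X)`. [folklore] -/
theorem frobenius_norm_eq_sqrt_hsS (X : Matrix (Fin N) (Fin N) ℂ) : ‖X‖ = Real.sqrt (((Xᴴ * X).trace).re) := by
  rw [← frobenius_norm_sq_eq_hsS, Real.sqrt_sq (norm_nonneg _)]

/-- **`a ↦ a^g` is an isometry of the chart** (sup over links of the Frobenius norm). [folklore] -/
theorem norm_conjFluct (a : Fin 4 → FinTorusSite n₀ n₁ n₂ n₃ → Matrix (Fin N) (Fin N) ℂ) :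
    ‖conjFluct (fun y => (g y : Matrix (Fin N) (Fin N) ℂ)) a‖ = ‖a‖ := by
  have hpt : ∀ μ x, ‖conjFluct (fun y => (g y : Matrix (Fin N) (Fin N) ℂ)) a μ x‖ = ‖a μ x‖ := fun μ x => by
    have hg' : (g x : Matrix (Fin N) (Fin N) ℂ) * ((g x : Matrix.specialUnitaryGroup (Fin N) ℂ) : Matrix (Fin N) (Fin N) ℂ)ᴴ = 1 := (g x).2.1.2
    simp only [conjFluct]
    rw [frobenius_norm_eq_sqrt_hsS, frobenius_norm_eq_sqrt_hsS, hsRe_conj' hg']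
  refine le_antisymm ?_ ?_
  · refine (pi_norm_le_iff_of_nonneg (norm_nonneg a)).2 fun μ => (pi_norm_le_iff_of_nonneg (norm_nonneg a)).2 fun x => ?_
    rw [hpt]
    exact (norm_le_pi_norm (a μ) x).trans (norm_le_pi_norm a μ)
  · refine (pi_norm_le_iff_of_nonneg (norm_nonneg _)).2 fun μ => (pi_norm_le_iff_of_nonneg (norm_nonneg _)).2 fun x => ?_
    rw [← hpt]
    exact (norm_le_pi_norm (conjFluct (fun y => (g y : Matrix (Fin N) (Fin N) ℂ)) a μ) x).trans
      (norm_le_pi_norm (conjFluct (fun y => (g y : Matrix (Fin N) (Fin N) ℂ)) a) μ)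

end Transport

/-! ## §2 One Taylor window for the whole orbit -/

section Uniform

/-- ★★ **One second-order Taylor window for the whole gauge orbit of `L`.**  For every `ε > 0` there is `δ > 0` such that for EVERY gauge map `g`
and every fluctuation `a` with `‖a‖ < δ`:
`|chartAction_{↑(g•L)}(a) − chartAction_{↑(g•L)}(0) − D(0)a − ½ D²(0)(a,a)| ≤ ε ‖a‖²` — exact transport along the orbit, no compactness needed.
[cite: Breitung1994, Thm 41 proof (the second-order expansion at the critical point)] -/
theorem taylor_two_uniform_on_orbit (L : FinTorusSite n₀ n₁ n₂ n₃ × Fin 4 → Matrix.specialUnitaryGroup (Fin N) ℂ)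
    (c : FinTorusSite n₀ n₁ n₂ n₃ → Fin 4 → Fin 4 → ℂ) {ε : ℝ} (hε : 0 < ε) :
    ∃ δ : ℝ, 0 < δ ∧ ∀ (g : FinTorusSite n₀ n₁ n₂ n₃ → Matrix.specialUnitaryGroup (Fin N) ℂ)
      (a : Fin 4 → FinTorusSite n₀ n₁ n₂ n₃ → Matrix (Fin N) (Fin N) ℂ), ‖a‖ < δ →
      |chartAction (fun e => ((gaugeAct g L e : Matrix.specialUnitaryGroup (Fin N) ℂ) : Matrix (Fin N) (Fin N) ℂ)) c a -
          chartAction (fun e => ((gaugeAct g L e : Matrix.specialUnitaryGroup (Fin N) ℂ) : Matrix (Fin N) (Fin N) ℂ)) c 0 -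
          fderiv ℝ (chartAction (fun e => ((gaugeAct g L e : Matrix.specialUnitaryGroup (Fin N) ℂ) : Matrix (Fin N) (Fin N) ℂ)) c) 0 a -
          (1 / 2) * fderiv ℝ (fderiv ℝ (chartAction (fun e => ((gaugeAct g L e : Matrix.specialUnitaryGroup (Fin N) ℂ) : Matrix (Fin N) (Fin N) ℂ)) c)) 0 a a|
        ≤ ε * ‖a‖ ^ 2 := by
  set U₀ := (fun e => ((L e : Matrix.specialUnitaryGroup (Fin N) ℂ) : Matrix (Fin N) (Fin N) ℂ)) with hU₀
  have hO := (isLittleO_chartAction_taylor_two U₀ c 0).def hε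
  obtain ⟨δ, hδ, hball⟩ := Metric.eventually_nhds_iff.1 hO
  refine ⟨δ, hδ, fun g a ha => ?_⟩
  have hag : dist (conjFluct (fun y => (g y : Matrix (Fin N) (Fin N) ℂ)) a) 0 < δ := by
    rw [dist_zero_right, norm_conjFluct]; exact ha
  have h := hball hag
  rw [taylorRemainder_gaugeAct]
  simp only [sub_zero, Real.norm_eq_abs, norm_conjFluct] at h
  rwa [abs_of_nonneg (by positivity : (0 : ℝ) ≤ ‖a‖ ^ 2)] at h

/-- ★★ **`hS2` of the Morse–Bott Laplace method, uniformly on the orbit, on skew-Hermitian directions.**  At a unitary configuration `L` EATING the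
twist phases `c` (a classical vacuum), for every `ε > 0` there is `δ > 0` such that for every gauge map `g` and every SKEW-HERMITIAN `a` with
`‖a‖ < δ`: `|chartAction_{↑(g•L)}(a) − ½ D² chartAction_{↑(g•L)}(0)(a, a)| ≤ ε ‖a‖²` (the constant term is `0` and the linear term vanishes on the
tangent directions of the group, K4). [cite: Breitung1994, Thm 41] [cite: GarciaperezGonzalezarroyoOkawa2017, §2.2–2.3] -/
theorem hS2_uniform_on_orbit_skew (L : FinTorusSite n₀ n₁ n₂ n₃ × Fin 4 → Matrix.specialUnitaryGroup (Fin N) ℂ)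
    {c : FinTorusSite n₀ n₁ n₂ n₃ → Fin 4 → Fin 4 → ℂ} (hc : ∀ x μ ν, star (c x μ ν) * c x μ ν = 1)
    (heat : ∀ (x : FinTorusSite n₀ n₁ n₂ n₃) (μ ν : Fin 4), μ < ν →
      bgPlaq (fun e => ((L e : Matrix.specialUnitaryGroup (Fin N) ℂ) : Matrix (Fin N) (Fin N) ℂ)) x μ ν = star (c x μ ν) • (1 : Matrix (Fin N) (Fin N) ℂ))
    {ε : ℝ} (hε : 0 < ε) :
    ∃ δ : ℝ, 0 < δ ∧ ∀ (g : FinTorusSite n₀ n₁ n₂ n₃ → Matrix.specialUnitaryGroup (Fin N) ℂ)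
      (a : Fin 4 → FinTorusSite n₀ n₁ n₂ n₃ → Matrix (Fin N) (Fin N) ℂ), (∀ μ x, (a μ x)ᴴ = -a μ x) → ‖a‖ < δ →
      |chartAction (fun e => ((gaugeAct g L e : Matrix.specialUnitaryGroup (Fin N) ℂ) : Matrix (Fin N) (Fin N) ℂ)) c a -
          (1 / 2) * fderiv ℝ (fderiv ℝ (chartAction (fun e => ((gaugeAct g L e : Matrix.specialUnitaryGroup (Fin N) ℂ) : Matrix (Fin N) (Fin N) ℂ)) c)) 0 a a|
        ≤ ε * ‖a‖ ^ 2 := by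
  obtain ⟨δ, hδ, hT⟩ := taylor_two_uniform_on_orbit L c hε
  refine ⟨δ, hδ, fun g a hskew ha => ?_⟩
  have h := hT g a ha
  have hL : ∀ e, ((L e : Matrix.specialUnitaryGroup (Fin N) ℂ) : Matrix (Fin N) (Fin N) ℂ) ∈ Matrix.unitaryGroup (Fin N) ℂ := fun e => (L e).2.1
  have hg : ∀ y, ((g y : Matrix.specialUnitaryGroup (Fin N) ℂ) : Matrix (Fin N) (Fin N) ℂ) ∈ Matrix.unitaryGroup (Fin N) ℂ := fun y => (g y).2.1
  -- constant term: the chart action vanishes at the (gauge-transformed) eater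
  have h0 : chartAction (fun e => ((gaugeAct g L e : Matrix.specialUnitaryGroup (Fin N) ℂ) : Matrix (Fin N) (Fin N) ℂ)) c 0 = 0 := by
    rw [chartAction_gaugeAct, conjFluct_zero, chartAction_eq_lineAction_one]
    have hz := lineAction_zero (U := fun e => ((L e : Matrix.specialUnitaryGroup (Fin N) ℂ) : Matrix (Fin N) (Fin N) ℂ))
      (a := (0 : Fin 4 → FinTorusSite n₀ n₁ n₂ n₃ → Matrix (Fin N) (Fin N) ℂ)) hc heat
    -- `lineAction U 0 c 1 = lineAction U 0 c 0` since the line through `0` is constant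
    have hconst : lineAction (fun e => ((L e : Matrix.specialUnitaryGroup (Fin N) ℂ) : Matrix (Fin N) (Fin N) ℂ))
        (0 : Fin 4 → FinTorusSite n₀ n₁ n₂ n₃ → Matrix (Fin N) (Fin N) ℂ) c 1 =
        lineAction (fun e => ((L e : Matrix.specialUnitaryGroup (Fin N) ℂ) : Matrix (Fin N) (Fin N) ℂ))
        (0 : Fin 4 → FinTorusSite n₀ n₁ n₂ n₃ → Matrix (Fin N) (Fin N) ℂ) c 0 := by
      simp only [lineAction, linePlaq, plaqHol, Pi.zero_apply, smul_zero]
    rw [hconst, hz]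
  -- linear term: vanishes on skew directions
  have h1 : fderiv ℝ (chartAction (fun e => ((gaugeAct g L e : Matrix.specialUnitaryGroup (Fin N) ℂ) : Matrix (Fin N) (Fin N) ℂ)) c) 0 a = 0 := by
    rw [fderiv_chartAction_gaugeAct_apply]
    exact fderiv_chartAction_zero_apply_eq_zero hL hc heat (conjFluct_skew hskew)
  rw [h0, h1, sub_zero, sub_zero] at h
  exact h

end Uniform

end Summit.QuantumFields.YangMills.Cruxes.IRcof.TwistedSlab

end
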